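import Summits.AtomisticToContinuum.BoseEinsteinCondensation.Theses.BECLaplacianL1

/-!
# AtomisticToContinuum / BoseEinsteinCondensation — route `BECLaplacianL1`, assembly

Settles the assembly item `stmt-AtomisticToContinuum-9013` of route
`route-AtomisticToContinuum-BECLaplacianL1`: the implication
`KineticCoherenceL1 → DiluteEnergyBound → ModeCountingL1 → BoundaryTransferWeak →
BoseEinsteinCondensation`.

The hypotheses of `Assembly` are, verbatim and in the same order, those of the route's deciding
theorem `closes`, so the assembly is that theorem; the composition is spelled out again below for
the record: fix a repulsive finite-range `v`; `ModeCountingL1` fed with the `v`-instances of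
`KineticCoherenceL1` (small `L¹` norm of the kinetic coherence of torus near-minimisers) and
`DiluteEnergyBound` (crude `E₀^per ≤ C ρ^{2/3} N`) gives periodic BEC for `v` (constant-mode
occupation `≥ c N`), and `BoundaryTransferWeak` turns that into `∃ ρ₀, ∀ ρ < ρ₀, HasGroundStateBEC v ρ`,
i.e. the sub-problem statement `BoseEinsteinCondensation`. Pure logic; no analytic content lives
here.
-/

namespace Summit.AtomisticToContinuum.BoseEinsteinCondensation.Theorems

/-- Settles `stmt-AtomisticToContinuum-9013` (exact signature): the assembly of route
`BECLaplacianL1`, i.e. its four items imply the sub-problem statement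
`BoseEinsteinCondensation`. Proof: for each repulsive finite-range `v`, `BoundaryTransferWeak`
applied to the periodic BEC produced by `ModeCountingL1` from `KineticCoherenceL1` and
`DiluteEnergyBound`. [folklore] -/
theorem becLaplacianL1_assembly_proof :
    Summit.AtomisticToContinuum.BoseEinsteinCondensation.Theses.BECLaplacianL1.Assembly := by
  unfold Theses.BECLaplacianL1.Assembly
  intro h₁ h₂ h₃ h₄ v hv
  exact h₄ v hv (h₃ v hv (h₁ v hv) (h₂ v hv))

end Summit.AtomisticToContinuum.BoseEinsteinCondensation.Theorems
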